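import Summits.CriticalPhenomena.PercolationContinuityZ3.Theorems.PercNearOneGluingNoHeavyLowerTailFKClusterTreeHarris
import HarnessLib

/-!
# FK sub-lane: the cluster-conditional Harris inequality for `φ_{𝐩,q}` along the exploration of the cluster of a vertex SET

Support file (`--supports stmt-CriticalPhenomena-4575`), FK sub-lane `prim-bschramm-fk-2` (gen 3); builds on p205010 (kernel theorem,
internal audit signed; external expert review pending).  No definitions, no named facts, no sorries; standard axioms.

The set version of `FK.clusterHarris_rc` (p215317): for `φ = rcMeasureW w q B`, `q ≥ 1`, a finite vertex set `N` and increasing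
events `A, A'`,
  `φ(A)·φ(A') ≤ Σ_ω φ{ω} · φ(A | C_N = C_N(ω)) · φ(A' | C_N = C_N(ω))`,      (`FK.setClusterHarris_rc`)
`C_N = ⋃_{n ∈ N} C_n` (`BHK2006.setCl`), i.e. `Cov(E[1_A | σ(C_N)], E[1_{A'} | σ(C_N)]) ≥ 0` — Gladkov's decision-tree Harris
inequality (`FK.treeHarris_rc`) along the full exploration of `C_N` (`SetClusterExploration.ttree` from `init N` over the non-loop
pairs, converted by `FK.dtrOfDTree`), whose cylinders are exactly the classes `{C_N = W}` (`FK.cyl_setClusterTree_eq`).  This is the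
tree-Harris input of hp-8's Lemma (★^H) ((K7) of PROOF-S5-ALL-R) for the random-cluster measure (bschramm/FK-Q2.md §12.6(c)).
[cite: Gladkov2024, Def. 2.4, Example 2.5 (p. 3), Thm. 3.2 (p. 4)] [cite: Grimmett2006, Thm. (3.7) (p. 39), Thm. (3.8)(b)]
[cite: VandenbergHaggstromKahn2005, §2.1 p. 9 (`C_S`)]
-/

noncomputable section

namespace Summit.CriticalPhenomena.PercolationContinuityZ3.Theorems.FK

open MeasureTheory Set
open Literature.Probability.LatticeModels Literature.Probability.Percolation
open Literature.Probability.Percolation.DecisionTree (revealed ind ind_of_mem ind_of_not_mem ind_nonneg)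
open Literature.Probability.Percolation.SetClusterExploration (ttree init revealedAt reached revealedAt_eq_revealed mem_revealedAt_iff
  mem_reached_iff fin_congr)
open Literature.Probability.Percolation.BHK2006 (setCl mem_setCl_iff setCl_subset setReach_iff)
open Summit.CriticalPhenomena.PercolationContinuityZ3.Theorems.MonotonicTree (DTr)
open scoped Classical

variable {V : Type*} [Fintype V]

/-! ### The open edge cluster of a vertex set -/

omit [Fintype V] in
/-- `e ∈ C_N` iff `e` is an open non-loop pair with an endpoint joined to `N`. [cite: VandenbergHaggstromKahn2005, §2.1 p. 9 (`C_S`)] -/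
theorem mem_setCl_iff_exists_reachable (ω : BondConfig V) (N : Set V) (e : Sym2 V) :
    e ∈ setCl ω N ↔ e ∈ ω ∧ ¬ e.IsDiag ∧ ∃ u ∈ e, ∃ n ∈ N, (openGraph ω).Reachable n u := by
  rw [mem_setCl_iff]
  constructor
  · rintro ⟨n, hn, he⟩
    have he' := (mem_openEdgeCluster_iff ω n e).1 he
    induction e using Sym2.ind with
    | h a b => exact ⟨he'.1, he'.2.1, a, Sym2.mem_mk_left _ _, n, hn, he'.2.2 a (Sym2.mem_mk_left _ _)⟩
  · rintro ⟨he, hd, u, hue, n, hn, hnu⟩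
    exact ⟨n, hn, mem_openEdgeCluster_of_mem he hd hue hnu⟩

omit [Fintype V] in
/-- Two configurations with the same `C_N` have the same vertices joined to `N`. [cite: VandenbergHaggstromKahn2005, §1 p. 3] -/
theorem setReachable_iff_of_setCl_eq {ω ω' : BondConfig V} {N : Set V} (h : setCl ω' N = setCl ω N) (u : V) :
    (∃ n ∈ N, (openGraph ω').Reachable n u) ↔ ∃ n ∈ N, (openGraph ω).Reachable n u := by
  rw [setReach_iff, setReach_iff, h]

/-! ### The exploration tree of the cluster of a set -/

/-- **The revealed pairs of the full exploration of `C_N` are the non-loop pairs meeting the vertex cluster of `N`.**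
[cite: Gladkov2024, §2 Example 2.5 (p. 3)] -/
theorem mem_revealedAt_setCluster_iff (N : Finset V) (ω : BondConfig V) (e : Sym2 V) :
    e ∈ revealedAt (Finset.univ.filter fun e : Sym2 V => ¬ e.IsDiag) N (Finset.univ.filter fun e : Sym2 V => e ∈ ω) ↔
      ¬ e.IsDiag ∧ ∃ u ∈ e, ∃ n ∈ N, (openGraph ω).Reachable n u := by
  rw [mem_revealedAt_iff]
  simp only [Finset.mem_filter, Finset.mem_univ, true_and]
  constructor
  · rintro ⟨hd, u, hu, hue⟩
    rw [mem_reached_iff] at hu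
    obtain ⟨n, hn, hnu⟩ := hu
    rw [openGraph_filter_nonDiag] at hnu
    exact ⟨hd, u, hue, n, hn, hnu⟩
  · rintro ⟨hd, u, hue, n, hn, hnu⟩
    refine ⟨hd, u, ?_, hue⟩
    rw [mem_reached_iff]
    refine ⟨n, hn, ?_⟩
    rw [openGraph_filter_nonDiag]
    exact hnu

/-- **The cylinders of the exploration tree of `C_N` are the events `{C_N = W}`**: a configuration agrees with `ω` on the non-loop
pairs meeting the vertex cluster of `N` in `ω` iff it has the same open edge cluster of the set `N`.
[cite: Gladkov2024, Lemma 3.1, Example 2.5 (p. 3)] [cite: VandenbergHaggstromKahn2005, §2.1 Lemma 2.3 (p. 10)] -/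
theorem cyl_setClusterTree_eq (N : Finset V) (ω : BondConfig V) :
    (dtrOfDTree (ttree (Finset.univ.filter fun e : Sym2 V => ¬ e.IsDiag)
        ((Finset.univ.filter fun e : Sym2 V => ¬ e.IsDiag).card + 1) (init N))).cyl
        (fun e => {ω' : BondConfig V | e ∈ ω'}) ω =
      {ω' : BondConfig V | setCl ω' (↑N : Set V) = setCl ω ↑N} := by
  set D : Finset (Sym2 V) := Finset.univ.filter fun e : Sym2 V => ¬ e.IsDiag with hD
  set K : Finset (Sym2 V) := Finset.univ.filter fun e : Sym2 V => e ∈ ω with hK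
  have hKω : ∀ e, e ∈ K ↔ e ∈ ω := fun e => by simp [hK]
  have hrev : revealed (ttree D (D.card + 1) (init N)) K = revealedAt D N K := (revealedAt_eq_revealed (D := D) N K).symm
  rw [cyl_dtrOfDTree _ K ω hKω, hrev]
  ext ω'
  simp only [Set.mem_setOf_eq]
  constructor
  · intro hagree
    set K' : Finset (Sym2 V) := Finset.univ.filter fun e : Sym2 V => e ∈ ω' with hK'
    have hK'ω : ∀ e, e ∈ K' ↔ e ∈ ω' := fun e => by simp [hK']
    have hfin := fin_congr (D := D) (N := N) (K := K) (K' := K') fun e he => by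
      rw [hKω, hK'ω]; exact (hagree e he).symm
    have hreach : ∀ u, (∃ n ∈ N, (openGraph ω').Reachable n u) ↔ ∃ n ∈ N, (openGraph ω).Reachable n u := by
      intro u
      have e1 : u ∈ reached D N K' ↔ ∃ n ∈ N, (openGraph ω').Reachable n u := by
        rw [mem_reached_iff, hK', openGraph_filter_nonDiag]
      have e2 : u ∈ reached D N K ↔ ∃ n ∈ N, (openGraph ω).Reachable n u := by
        rw [mem_reached_iff, hK, openGraph_filter_nonDiag]
      rw [← e1, ← e2, reached, reached, hfin]
    ext e
    rw [mem_setCl_iff_exists_reachable, mem_setCl_iff_exists_reachable]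
    constructor
    · rintro ⟨he', hd, u, hue, hr⟩
      have hr' : ∃ n ∈ (↑N : Set V), (openGraph ω).Reachable n u := by
        obtain ⟨n, hn, hnu⟩ := hr
        obtain ⟨n', hn', hn'u⟩ := (hreach u).1 ⟨n, hn, hnu⟩
        exact ⟨n', hn', hn'u⟩
      have hrevd : e ∈ revealedAt D N K := by
        obtain ⟨n', hn', hn'u⟩ := hr'
        exact (mem_revealedAt_setCluster_iff N ω e).2 ⟨hd, u, hue, n', hn', hn'u⟩
      exact ⟨(hagree _ hrevd).1 he', hd, u, hue, hr'⟩
    · rintro ⟨he, hd, u, hue, hr⟩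
      have hr' : ∃ n ∈ (↑N : Set V), (openGraph ω').Reachable n u := by
        obtain ⟨n, hn, hnu⟩ := hr
        obtain ⟨n', hn', hn'u⟩ := (hreach u).2 ⟨n, hn, hnu⟩
        exact ⟨n', hn', hn'u⟩
      have hrevd : e ∈ revealedAt D N K := by
        obtain ⟨n, hn, hnu⟩ := hr
        exact (mem_revealedAt_setCluster_iff N ω e).2 ⟨hd, u, hue, n, hn, hnu⟩
      exact ⟨(hagree _ hrevd).2 he, hd, u, hue, hr'⟩
  · intro hC e he
    obtain ⟨hd, u, hue, n, hn, hnu⟩ := (mem_revealedAt_setCluster_iff N ω e).1 he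
    have hr' : ∃ n ∈ (↑N : Set V), (openGraph ω').Reachable n u :=
      (setReachable_iff_of_setCl_eq hC u).2 ⟨n, hn, hnu⟩
    constructor
    · intro he'
      have : e ∈ setCl ω' ↑N := (mem_setCl_iff_exists_reachable ω' ↑N e).2 ⟨he', hd, u, hue, hr'⟩
      rw [hC] at this
      exact setCl_subset ω ↑N this
    · intro heω
      have : e ∈ setCl ω ↑N := (mem_setCl_iff_exists_reachable ω ↑N e).2 ⟨heω, hd, u, hue, n, hn, hnu⟩
      rw [← hC] at this
      exact setCl_subset ω' ↑N this

/-- **The cluster-conditional Harris inequality for `φ_{𝐩,q}` along `σ(C_N)`** (`q ≥ 1`): for increasing events `A, A'` and a finite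
vertex set `N`, `φ(A)·φ(A') ≤ Σ_ω φ{ω}·φ(A | C_N = C_N(ω))·φ(A' | C_N = C_N(ω))` (`φ = rcMeasureW w q B`; real division) —
decision-tree Harris along the full exploration of the cluster of `N`.
[cite: Gladkov2024, Thm. 3.2 (p. 4)] [cite: Grimmett2006, Thm. (3.7) (p. 39), Thm. (3.8)(b)] -/
theorem setClusterHarris_rc (w : Sym2 V → unitInterval) {q : ℝ} (hq : 1 ≤ q) (B : Set V) (N : Finset V)
    {A A' : Set (BondConfig V)} (hA : IsUpperSet A) (hA' : IsUpperSet A') :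
    (rcMeasureW w q B).real A * (rcMeasureW w q B).real A' ≤
      ∑ ω : BondConfig V, (rcMeasureW w q B).real {ω} *
        ((rcMeasureW w q B).real (A ∩ {ω' | setCl ω' (↑N : Set V) = setCl ω ↑N}) /
          (rcMeasureW w q B).real {ω' | setCl ω' (↑N : Set V) = setCl ω ↑N}) *
        ((rcMeasureW w q B).real (A' ∩ {ω' | setCl ω' (↑N : Set V) = setCl ω ↑N}) /
          (rcMeasureW w q B).real {ω' | setCl ω' (↑N : Set V) = setCl ω ↑N}) := by
  have h := treeHarris_rc w hq B hA hA' (dtrOfDTree (ttree (Finset.univ.filter fun e : Sym2 V => ¬ e.IsDiag)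
    ((Finset.univ.filter fun e : Sym2 V => ¬ e.IsDiag).card + 1) (init N)))
  simp only [cyl_setClusterTree_eq] at h
  exact h

end Summit.CriticalPhenomena.PercolationContinuityZ3.Theorems.FK

end
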